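import Summits.CriticalPhenomena.CardyFormulaZ2.Theorems.CardyComplexConeEdgePrecompactUFRSJunctionGateProbGeneric
import Literature.Probability.Percolation.ThinAnnulusCircuits

/-!
# The junction gate has probability bounded below (S1 of the per-scale junction bound HJ-S)
(line `qkz-strip-boundary-arm` of crux `CardyComplexCone.EdgePrecompact`, stmt-CriticalPhenomena-11387;
third and last file of the registered sub-goal S1 = `ufrs_junctionGate_prob`, lead c5 wave 3)

**Theorem** (`ufrs_junctionGate_prob`, registered). There are `c > 0` and `N₀` such that for every
graph automorphism `φ` of `ℤ²`, both cases `corner ∈ {false, true}`, every scale `N ≥ N₀` and depth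
`h ≤ N`, `P_{1/2}(ufrsJunctionGate φ corner N h) ≥ c` (`…UFRSJunctionGate.lean`).

Proof. By `real_ufrsJunctionGate` it suffices to treat the reference gate `ufrsGateRef corner N h`.
The generic bound `real_ufrsGateWith_ge` (`…UFRSJunctionGateProbGeneric.lean`) is run with the
box `[-4N, 4N] × [2N, 4N]` (the bar; flat case) resp. `[-h, 4N] × [2N, 4N]` (corner case) and the
dual rectangle of faces `[-4N, -2N-1] × [-h-1, 4N]` resp. `[2N, 4N-1] × [-h-1, 4N]`, a
`2N × (4N + h + 2)` dual box whose closed dual top-bottom crossing has probability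
`crossingProb half (4N+h+1) (2N-1) ≥ c₆` (self-duality `real_dualTBCrossing_succ`, RSW at aspect
ratio `6`, `rsw_half_holds.ratio`). The event "the explored set contains an open left-right
crossing of the box" contains, on lattice configurations: (flat) the intersection of an open
top-bottom crossing of the pillar `[2N, 4N] × [-h, 4N]` and an open left-right crossing of the bar
— they meet (`exists_mem_support_of_crossing`), so every vertex of the bar crossing is joined to
the foot row inside the region, i.e. explored — of probability `≥ c₃ c₄` (RSW at ratios `3`, `4`,
Harris); (corner) an open left-right crossing of the bar, which starts on the foot column, of
probability `≥ c₃`. Hence `c = c₆ c₃ c₄` and `N₀ = 1`.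

References: H. Kesten, Comm. Math. Phys. 109 (1987), §2; L. Russo, Z. Wahrsch. 43 (1978);
P. Seymour, D. Welsh, Ann. Discrete Math. 3 (1978); G. Grimmett, *Percolation* (1999), §11.7.
-/

namespace Summit.CriticalPhenomena.CardyFormulaZ2.Cruxes.EdgePrecompact.QkzStripBoundaryArm

open MeasureTheory Filter Set Metric
open scoped Topology BigOperators Pointwise
open Literature.Probability.LatticeModels Literature.Probability.Percolation
open Literature.Probability.RandomPlanarGeometry (DobrushinDomain)
open Summit.CriticalPhenomena.CardyFormulaZ2.Theses.CardyComplexCone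

noncomputable section

open SimpleGraph

/-! ## Vertices of glued crossings are explored -/

/-- **A walk hanging off the foot runs inside the explored set.** If `T` is an open walk inside
`In ∪ Blk` starting in `In` and `T'` an open walk inside `In ∪ Blk` sharing a vertex with `T`, then
every vertex of `T'` is explored. -/
theorem support_subset_explSet_HJ {In Blk : Set (Site 2)} {ω : BondConfig (Site 2)} {x z' x' y' : Site 2}
    (T : (zdGraph 2).Walk x z') (T' : (zdGraph 2).Walk x' y') (hx : x ∈ In)
    (hTs : ∀ v ∈ T.support, v ∈ In ∪ Blk) (hTe : ∀ e ∈ T.edges, e ∈ ω)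
    (hT's : ∀ v ∈ T'.support, v ∈ In ∪ Blk) (hT'e : ∀ e ∈ T'.edges, e ∈ ω)
    {z : Site 2} (hzT : z ∈ T.support) (hzT' : z ∈ T'.support) :
    ∀ v ∈ T'.support, v ∈ explSet In Blk ω := by
  classical
  intro v hv
  have h1 : ω ∈ openConnIn (In ∪ Blk) x z := mem_openConnIn_of_mem_support T hTs hTe hzT
  have h2 : ω ∈ openConnIn (In ∪ Blk) x' z := mem_openConnIn_of_mem_support T' hT's hT'e hzT'
  have h3 : ω ∈ openConnIn (In ∪ Blk) x' v := mem_openConnIn_of_mem_support T' hT's hT'e hv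
  have h4 : ω ∈ openConnIn (In ∪ Blk) z v := PlanarDuality.openConnIn_trans ((openConnIn_comm _ _ _).le h2) h3
  exact mem_explSet_iff_exists.2 ⟨hT's v hv, x, hx, PlanarDuality.openConnIn_trans h1 h4⟩

/-! ## RSW inputs -/

/-- **The closed dual crossing of the `2N × (4N + h + 2)` dual box** has probability `≥ c₆` when
`c₆ ≤ crossingProb half (6 l) l` for all `l ≥ 1`, `1 ≤ N` and `h ≤ N`. -/
theorem le_real_dualTBCrossingAt_HJ {c₆ : ℝ} (hc₆ : ∀ l : ℕ, 1 ≤ l → c₆ ≤ crossingProb half (6 * l) l)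
    {N h : ℕ} (hN : 1 ≤ N) (hh : h ≤ N) (u : Site 2) :
    c₆ ≤ (bondPercolation (zdGraph 2) half).real (dualTBCrossingAt u (2 * N - 1 + 1) (4 * N + h)) := by
  rw [real_dualTBCrossingAt, real_dualTBCrossing_succ, symm_half]
  refine (hc₆ (2 * N - 1) (by omega)).trans (crossingProb_anti_left half (by omega) _)

/-- **The open top-bottom crossing of the pillar `[2N, 4N] × [-h, 4N]`** has probability `≥ c₃`
when `c₃ ≤ crossingProb half (3 l) l` for all `l ≥ 1`, `1 ≤ N`, `h ≤ N`. -/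
theorem le_real_tbCrossing_pillar_HJ {c₃ : ℝ} (hc₃ : ∀ l : ℕ, 1 ≤ l → c₃ ≤ crossingProb half (3 * l) l)
    {N h : ℕ} (hN : 1 ≤ N) (hh : h ≤ N) (u : Site 2) :
    c₃ ≤ (bondPercolation (zdGraph 2) half).real (openCrossing ((· + u) '' (↑(rectangle (2 * N) (4 * N + h)) : Set (Site 2)))
      ((· + u) '' (↑(bottomSide (2 * N) (4 * N + h)) : Set (Site 2))) ((· + u) '' (↑(topSide (2 * N) (4 * N + h)) : Set (Site 2)))) := by
  rw [bondPercolation_real_tbCrossingAt]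
  exact (hc₃ (2 * N) (by omega)).trans (crossingProb_anti_left half (by omega) _)

/-- **The open left-right crossing of a `(4N + h) × 2N` bar** has probability `≥ c₃` (ratio `≤ 3`). -/
theorem le_real_lrCrossingAt_bar_HJ {c₃ : ℝ} (hc₃ : ∀ l : ℕ, 1 ≤ l → c₃ ≤ crossingProb half (3 * l) l)
    {N h : ℕ} (hN : 1 ≤ N) (hh : h ≤ N) (u : Site 2) :
    c₃ ≤ (bondPercolation (zdGraph 2) half).real (lrCrossingAt u (4 * N + h) (2 * N)) := by
  rw [bondPercolation_real_lrCrossingAt]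
  exact (hc₃ (2 * N) (by omega)).trans (crossingProb_anti_left half (by omega) _)

/-- **The open left-right crossing of the `8N × 2N` bar** has probability `≥ c₄` (ratio `4`). -/
theorem le_real_lrCrossingAt_longbar_HJ {c₄ : ℝ} (hc₄ : ∀ l : ℕ, 1 ≤ l → c₄ ≤ crossingProb half (4 * l) l)
    {N : ℕ} (hN : 1 ≤ N) (u : Site 2) :
    c₄ ≤ (bondPercolation (zdGraph 2) half).real (lrCrossingAt u (8 * N) (2 * N)) := by
  rw [bondPercolation_real_lrCrossingAt, show 8 * N = 4 * (2 * N) by ring]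
  exact hc₄ (2 * N) (by omega)

/-! ## The flat case -/

/-- **Flat case: the explored set of the pillar-and-bar contains a crossing of the bar with
probability `≥ c₃ c₄`.** -/
theorem le_real_explCross_flat_HJ {c₃ c₄ : ℝ} (hc₄0 : 0 ≤ c₄) (hc₃ : ∀ l : ℕ, 1 ≤ l → c₃ ≤ crossingProb half (3 * l) l)
    (hc₄ : ∀ l : ℕ, 1 ≤ l → c₄ ≤ crossingProb half (4 * l) l) {N h : ℕ} (hN : 1 ≤ N) (hh : h ≤ N) :
    c₃ * c₄ ≤ (bondPercolation (zdGraph 2) half).real {ω : BondConfig (Site 2) | ∃ x y : Site 2, x 0 = -(4 * N : ℤ) ∧ y 0 = 4 * N ∧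
      ω ∈ openConnIn ({z : Site 2 | -(4 * N : ℤ) ≤ z 0 ∧ z 0 ≤ 4 * N ∧ (2 * N : ℤ) ≤ z 1 ∧ z 1 ≤ 4 * N} ∩
        explSet (ufrsGateFA false N h) (ufrsGateRA false N h) ω) x y} := by
  set μ := bondPercolation (zdGraph 2) half with hμ
  set uP : Site 2 := ![(2 * N : ℤ), -(h : ℤ)] with huP
  set uB : Site 2 := ![-(4 * N : ℤ), (2 * N : ℤ)] with huB
  set EP : Set (BondConfig (Site 2)) := openCrossing ((· + uP) '' (↑(rectangle (2 * N) (4 * N + h)) : Set (Site 2)))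
      ((· + uP) '' (↑(bottomSide (2 * N) (4 * N + h)) : Set (Site 2)))
      ((· + uP) '' (↑(topSide (2 * N) (4 * N + h)) : Set (Site 2))) with hEP
  set EB : Set (BondConfig (Site 2)) := lrCrossingAt uB (8 * N) (2 * N) with hEB
  have hP : c₃ ≤ μ.real EP := le_real_tbCrossing_pillar_HJ hc₃ hN hh uP
  have hB : c₄ ≤ μ.real EB := le_real_lrCrossingAt_longbar_HJ hc₄ hN uB
  have hH := harris_fkg_holds (zdGraph 2) half (isUpperSet_openCrossing _ _ _) (isUpperSet_lrCrossingAt _ _ _)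
    (measurableSet_tbCrossingAt _ _ _) (measurableSet_lrCrossingAt _ _ _) (A := EP) (B := EB)
  have hincl : ∀ ω : BondConfig (Site 2), ω ⊆ (zdGraph 2).edgeSet → ω ∈ EP ∩ EB →
      ω ∈ {ω : BondConfig (Site 2) | ∃ x y : Site 2, x 0 = -(4 * N : ℤ) ∧ y 0 = 4 * N ∧
        ω ∈ openConnIn ({z : Site 2 | -(4 * N : ℤ) ≤ z 0 ∧ z 0 ≤ 4 * N ∧ (2 * N : ℤ) ≤ z 1 ∧ z 1 ≤ 4 * N} ∩
          explSet (ufrsGateFA false N h) (ufrsGateRA false N h) ω) x y} := by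
    rintro ω hω ⟨hωP, hωB⟩
    obtain ⟨x, y, T, hx, hy, hTs, hTe⟩ := exists_walk_of_mem_tbCrossingAt hω hωP
    obtain ⟨x', y', T', hx', hy', hT's, hT'e⟩ := exists_walk_of_mem_lrCrossingAt hω hωB
    simp only [huP, huB, Matrix.cons_val_zero, Matrix.cons_val_one] at hx hy hTs hx' hy' hT's
    push_cast at hx hy hTs hx' hy' hT's
    -- the two crossings meet
    obtain ⟨z, hzT', hzT⟩ := exists_mem_support_of_crossing (L := -(4 * N : ℤ)) (R := 4 * N) (B := -(h : ℤ)) (T := 4 * N)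
      T' T (fun v hv => by have := hT's v hv; omega) (fun v hv => by have := hTs v hv; omega) hx' (by omega) hx (by omega)
    -- hence the bar crossing is explored
    have hxFA : x ∈ ufrsGateFA false N h := by
      have := hTs x (Walk.start_mem_support T)
      exact ⟨by omega, by omega, by omega⟩
    have hTRA : ∀ v ∈ T.support, v ∈ ufrsGateFA false N h ∪ ufrsGateRA false N h := fun v hv => by
      have := hTs v hv
      exact Or.inr (Or.inl ⟨by omega, by omega, by omega, by omega⟩)
    have hT'RA : ∀ v ∈ T'.support, v ∈ ufrsGateFA false N h ∪ ufrsGateRA false N h := fun v hv => by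
      have := hT's v hv
      exact Or.inr (Or.inr ⟨by omega, by omega, by omega, by omega⟩)
    have hexpl := support_subset_explSet_HJ T T' hxFA hTRA hTe hT'RA hT'e hzT hzT'
    refine ⟨x', y', hx', by omega, mem_openConnIn_of_walk T' (fun v hv => ⟨?_, hexpl v hv⟩) hT'e⟩
    have := hT's v hv
    exact ⟨by omega, by omega, by omega, by omega⟩
  have hae : (EP ∩ EB : Set (BondConfig (Site 2))) ≤ᵐ[μ]
      ({ω : BondConfig (Site 2) | ∃ x y : Site 2, x 0 = -(4 * N : ℤ) ∧ y 0 = 4 * N ∧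
        ω ∈ openConnIn ({z : Site 2 | -(4 * N : ℤ) ≤ z 0 ∧ z 0 ≤ 4 * N ∧ (2 * N : ℤ) ≤ z 1 ∧ z 1 ≤ 4 * N} ∩
          explSet (ufrsGateFA false N h) (ufrsGateRA false N h) ω) x y} : Set (BondConfig (Site 2))) :=
    (ae_subset_edgeSet (zdGraph 2) half).mono fun ω hω h' => hincl ω hω h'
  calc c₃ * c₄ ≤ μ.real EP * μ.real EB := mul_le_mul hP hB hc₄0 measureReal_nonneg
    _ ≤ μ.real (EP ∩ EB) := hH
    _ ≤ _ := ENNReal.toReal_mono (measure_ne_top _ _) (measure_mono_ae hae)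

/-- **Flat case: the reference gate has probability `≥ c₆ c₃ c₄`.** -/
theorem le_real_ufrsGateRef_false_HJ {c₃ c₄ c₆ : ℝ} (hc₄0 : 0 ≤ c₄) (hc₆0 : 0 ≤ c₆)
    (hc₃ : ∀ l : ℕ, 1 ≤ l → c₃ ≤ crossingProb half (3 * l) l) (hc₄ : ∀ l : ℕ, 1 ≤ l → c₄ ≤ crossingProb half (4 * l) l)
    (hc₆ : ∀ l : ℕ, 1 ≤ l → c₆ ≤ crossingProb half (6 * l) l) {N h : ℕ} (hN : 1 ≤ N) (hh : h ≤ N) :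
    c₆ * (c₃ * c₄) ≤ (bondPercolation (zdGraph 2) half).real (ufrsGateRef false N h) := by
  have hgen := real_ufrsGateWith_ge (ufrsGateRA false N h) (ufrsGateFA false N h) (ufrsGateRB false N h) (ufrsGateFB false N h)
    (Finset.Icc ![-(4 * N : ℤ), -(h : ℤ)] ![(4 * N : ℤ), (4 * N : ℤ)]) (-(4 * N : ℤ)) (4 * N) (2 * N) (4 * N)
    ![-(4 * N : ℤ), -(h : ℤ)] (2 * N - 1 + 1) (4 * N + h) c₆ (ufrsGateFA_subset_ufrsGateRA false N h) ?_ ?_ ?_ ?_ ?_ ?_ hc₆0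
    (le_real_dualTBCrossingAt_HJ hc₆ hN hh _)
  · rw [ufrsGateRef_eq]
    exact (mul_le_mul_of_nonneg_left (le_real_explCross_flat_HJ hc₄0 hc₃ hc₄ hN hh) hc₆0).trans hgen
  · intro z hz
    rw [Finset.coe_Icc, Set.mem_Icc]
    rcases hz with ⟨h1, h2, h3, h4⟩ | ⟨h1, h2, h3, h4⟩ <;>
      exact ⟨fun i => by fin_cases i <;> simp <;> omega, fun i => by fin_cases i <;> simp <;> omega⟩
  · intro z hz; obtain ⟨h1, h2, h3, h4⟩ := hz; exact ⟨h1, by omega, h4⟩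
  · intro z hz; obtain ⟨h1, h2, h3⟩ := hz; omega
  · intro f h1 h2 h3 h4
    simp only [Matrix.cons_val_zero, Matrix.cons_val_one] at h1 h2 h3 h4
    push_cast at h1 h2 h3 h4
    exact ⟨by omega, by omega, by omega, by omega⟩
  · simp only [Matrix.cons_val_one]; push_cast; ring
  · intro f h1 h2 h3
    simp only [Matrix.cons_val_zero, Matrix.cons_val_one] at h1 h2 h3
    push_cast at h1 h2 h3
    exact ⟨by omega, by omega, by omega⟩

/-! ## The corner case -/

/-- **Corner case: the explored set of the bar contains a crossing of the bar with probability
`≥ c₃`.** -/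
theorem le_real_explCross_corner_HJ {c₃ : ℝ} (hc₃ : ∀ l : ℕ, 1 ≤ l → c₃ ≤ crossingProb half (3 * l) l)
    {N h : ℕ} (hN : 1 ≤ N) (hh : h ≤ N) :
    c₃ ≤ (bondPercolation (zdGraph 2) half).real {ω : BondConfig (Site 2) | ∃ x y : Site 2, x 0 = -(h : ℤ) ∧ y 0 = 4 * N ∧
      ω ∈ openConnIn ({z : Site 2 | -(h : ℤ) ≤ z 0 ∧ z 0 ≤ 4 * N ∧ (2 * N : ℤ) ≤ z 1 ∧ z 1 ≤ 4 * N} ∩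
        explSet (ufrsGateFA true N h) (ufrsGateRA true N h) ω) x y} := by
  set μ := bondPercolation (zdGraph 2) half with hμ
  set uB : Site 2 := ![-(h : ℤ), (2 * N : ℤ)] with huB
  set EB : Set (BondConfig (Site 2)) := lrCrossingAt uB (4 * N + h) (2 * N) with hEB
  have hB : c₃ ≤ μ.real EB := le_real_lrCrossingAt_bar_HJ hc₃ hN hh uB
  have hincl : ∀ ω : BondConfig (Site 2), ω ⊆ (zdGraph 2).edgeSet → ω ∈ EB →
      ω ∈ {ω : BondConfig (Site 2) | ∃ x y : Site 2, x 0 = -(h : ℤ) ∧ y 0 = 4 * N ∧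
        ω ∈ openConnIn ({z : Site 2 | -(h : ℤ) ≤ z 0 ∧ z 0 ≤ 4 * N ∧ (2 * N : ℤ) ≤ z 1 ∧ z 1 ≤ 4 * N} ∩
          explSet (ufrsGateFA true N h) (ufrsGateRA true N h) ω) x y} := by
    intro ω hω hωB
    obtain ⟨x', y', T', hx', hy', hT's, hT'e⟩ := exists_walk_of_mem_lrCrossingAt hω hωB
    simp only [huB, Matrix.cons_val_zero, Matrix.cons_val_one] at hx' hy' hT's
    push_cast at hx' hy' hT's
    have hxFA : x' ∈ ufrsGateFA true N h := by
      have := hT's x' (Walk.start_mem_support T')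
      exact ⟨hx', by omega, by omega⟩
    have hT'RA : ∀ v ∈ T'.support, v ∈ ufrsGateFA true N h ∪ ufrsGateRA true N h := fun v hv => by
      have := hT's v hv
      exact Or.inr ⟨by omega, by omega, by omega, by omega⟩
    have hexpl := support_subset_explSet_HJ T' T' hxFA hT'RA hT'e hT'RA hT'e (Walk.start_mem_support T')
      (Walk.start_mem_support T')
    refine ⟨x', y', hx', by omega, mem_openConnIn_of_walk T' (fun v hv => ⟨?_, hexpl v hv⟩) hT'e⟩
    have := hT's v hv
    exact ⟨by omega, by omega, by omega, by omega⟩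
  have hae : (EB : Set (BondConfig (Site 2))) ≤ᵐ[μ]
      ({ω : BondConfig (Site 2) | ∃ x y : Site 2, x 0 = -(h : ℤ) ∧ y 0 = 4 * N ∧
        ω ∈ openConnIn ({z : Site 2 | -(h : ℤ) ≤ z 0 ∧ z 0 ≤ 4 * N ∧ (2 * N : ℤ) ≤ z 1 ∧ z 1 ≤ 4 * N} ∩
          explSet (ufrsGateFA true N h) (ufrsGateRA true N h) ω) x y} : Set (BondConfig (Site 2))) :=
    (ae_subset_edgeSet (zdGraph 2) half).mono fun ω hω h' => hincl ω hω h'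
  exact hB.trans (ENNReal.toReal_mono (measure_ne_top _ _) (measure_mono_ae hae))

/-- **Corner case: the reference gate has probability `≥ c₆ c₃`.** -/
theorem le_real_ufrsGateRef_true_HJ {c₃ c₆ : ℝ} (hc₆0 : 0 ≤ c₆)
    (hc₃ : ∀ l : ℕ, 1 ≤ l → c₃ ≤ crossingProb half (3 * l) l)
    (hc₆ : ∀ l : ℕ, 1 ≤ l → c₆ ≤ crossingProb half (6 * l) l) {N h : ℕ} (hN : 1 ≤ N) (hh : h ≤ N) :
    c₆ * c₃ ≤ (bondPercolation (zdGraph 2) half).real (ufrsGateRef true N h) := by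
  have hgen := real_ufrsGateWith_ge (ufrsGateRA true N h) (ufrsGateFA true N h) (ufrsGateRB true N h) (ufrsGateFB true N h)
    (Finset.Icc ![-(h : ℤ), (2 * N : ℤ)] ![(4 * N : ℤ), (4 * N : ℤ)]) (-(h : ℤ)) (4 * N) (2 * N) (4 * N)
    ![(2 * N : ℤ), -(h : ℤ)] (2 * N - 1 + 1) (4 * N + h) c₆ (ufrsGateFA_subset_ufrsGateRA true N h) ?_ ?_ ?_ ?_ ?_ ?_ hc₆0
    (le_real_dualTBCrossingAt_HJ hc₆ hN hh _)
  · rw [ufrsGateRef_eq]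
    exact (mul_le_mul_of_nonneg_left (le_real_explCross_corner_HJ hc₃ hN hh) hc₆0).trans hgen
  · intro z hz
    rw [Finset.coe_Icc, Set.mem_Icc]
    obtain ⟨h1, h2, h3, h4⟩ := hz
    exact ⟨fun i => by fin_cases i <;> simp <;> omega, fun i => by fin_cases i <;> simp <;> omega⟩
  · intro z hz; obtain ⟨h1, h2, h3, h4⟩ := hz; exact ⟨by omega, h2, h4⟩
  · intro z hz; obtain ⟨h1, h2, h3⟩ := hz; omega
  · intro f h1 h2 h3 h4
    simp only [Matrix.cons_val_zero, Matrix.cons_val_one] at h1 h2 h3 h4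
    push_cast at h1 h2 h3 h4
    exact ⟨by omega, by omega, by omega, by omega⟩
  · simp only [Matrix.cons_val_one]; push_cast; ring
  · intro f h1 h2 h3
    simp only [Matrix.cons_val_zero, Matrix.cons_val_one] at h1 h2 h3
    push_cast at h1 h2 h3
    exact ⟨by omega, by omega, by omega⟩

/-! ## The registered statement -/

/-- **S1: the junction gate has probability bounded below, uniformly in the orientation, the case,
the scale and the depth** (registered sub-goal `ufrs_junctionGate_prob` of
stmt-CriticalPhenomena-11387, input S1 of `ufrs_junction_scale_le_of_gate`). See the module
docstring. -/
theorem ufrs_junctionGate_prob : ∃ c : ℝ, 0 < c ∧ ∃ N₀ : ℕ, ∀ (φ : zdGraph 2 ≃g zdGraph 2) (corner : Bool) (N h : ℕ), N₀ ≤ N → h ≤ N → c ≤ (bondPercolation (zdGraph 2) half).real (ufrsJunctionGate φ corner N h) := by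
  obtain ⟨c₃, hc₃pos, hc₃⟩ := rsw_half_holds.ratio (k := 3) (by norm_num)
  obtain ⟨c₄, hc₄pos, hc₄⟩ := rsw_half_holds.ratio (k := 4) (by norm_num)
  obtain ⟨c₆, hc₆pos, hc₆⟩ := rsw_half_holds.ratio (k := 6) (by norm_num)
  have hc₄1 : c₄ ≤ 1 := ((hc₄ 1 le_rfl).1).trans (crossingProb_mem_Icc half (4 * 1) 1).2
  refine ⟨c₆ * (c₃ * c₄), by positivity, 1, fun φ corner N h hN hh => ?_⟩
  rw [real_ufrsJunctionGate]
  cases corner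
  · exact le_real_ufrsGateRef_false_HJ hc₄pos.le hc₆pos.le (fun l hl => (hc₃ l hl).1) (fun l hl => (hc₄ l hl).1)
      (fun l hl => (hc₆ l hl).1) hN hh
  · calc c₆ * (c₃ * c₄) ≤ c₆ * c₃ := by
          have : c₃ * c₄ ≤ c₃ := by nlinarith
          exact mul_le_mul_of_nonneg_left this hc₆pos.le
      _ ≤ _ := le_real_ufrsGateRef_true_HJ hc₆pos.le (fun l hl => (hc₃ l hl).1) (fun l hl => (hc₆ l hl).1) hN hh

end

end Summit.CriticalPhenomena.CardyFormulaZ2.Cruxes.EdgePrecompact.QkzStripBoundaryArm
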